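import Mathlib
import Literature.MathematicalPhysics.QuantumFieldTheory.Balaban1983to89.B9Eq3169MuN

/-! # `Balaban1983to89.B9Eq3187Op` — (3.185) ⇒ (3.187) for OPERATOR-ENTRY (block) kernels: the norm-majorant
# reduction over any real normed ring, the operator entries E(b, b′) ∈ End 𝔤 of E = I + D̄μ(·) in the non-abelian
# model with RANGE D + 1 and OPERATOR-NORM ROW MASS ≤ 1 + 4ℓ (no dim 𝔤 factor), and the edges: B₀ = B₁e^{2δ₁r}m²
# with r = L, m = 1 + 4d(L − 1) *"depending on d and L only"* — kernel-checked, [folklore] analysis over the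
# printed formulas

CITATION HEADER (lean-in-tree rule).  Paper sub-cell `b2b-balaban-b09` (gen 12, journal claim B9-EQ3187-OP, cell
pub-balaban) on T. Bałaban, *Propagators for lattice gauge theories in a background field*, Commun. Math. Phys. **99**
(1985) 389–434 [`Balaban1985BackgroundPropagators`] (= B9; held `paper:balaban1985-cmp99-background-propagators`;
journal page = PDF page + 388), p. 390 [PDF 2], p. 427 [PDF 39], p. 430 [PDF 42], p. 432 [PDF 44]; with [5] =
[`Balaban1985Averaging`] (CMP 98) p. 24 [PDF 8] THROUGH THE TREE ONLY (`B9Eq3169Comb.BondModel.frame`, by name).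
Renders `b2b-balaban-ref1/pages/1985-cmp99-background-propagators/…-p002-x2.png`, `…-p039-x2.png`, `…-p042-x2.png`,
`…-p044-x2.png` READ AS IMAGES by this seat (gen 12).  ABSOLUTE RULE: nothing is cited beyond verbatim print with
page references; B9 is not cited for any disputed step — (3.185) and the random-walk bound of QG̃₂Q* remain
HYPOTHESES (G-B9-10 OPEN) exactly as in `B9Thm315Decay` (gen 11), `B9Eq3169Mu`/`B9Eq3169Comb`/`B9Eq3169MuN`
(gen 12).  Imports Mathlib + `…B9Eq3169MuN` (hence `…B9Eq3169Comb`, `…B9Eq3169Mu`, `…B9Thm315Decay`, `…B9`);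
no existing module is modified.

WHAT IS PRINTED (verbatim).
* p. 390 [PDF 2]: *"We will use the notations, the methods and the results of [1–5]. Let us remark only that in
  this paper a norm |X| of a N × N matrix means the Hilbert–Schmidt norm: |X|² = tr X*X."* and *"Let us recall that
  R(U)X = UXU⁻¹. This operation will be widely used in this paper, as it was in [5], …"*.
* p. 427 [PDF 39], (3.155): *"g is an arbitrary Lie algebra valued function defined at bonds of Λ"*.
* p. 430 [PDF 42], (3.168)–(3.169): *"This implies μ(y) = Q′(R_y(V)B)(Γ_{y,·}), μ(x) = R(V(Γ_{x,y}))Q′(R_y(V)B)(Γ_{y,·})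
  − R(V(Γ_{x,y}))(R_y(V)B)(Γ_{y,x}), x∈B(y), x ≠ y. (3.169) We denote the linear function defined by the above
  formulas by μ(B)."*
* p. 432 [PDF 44]: *"C^{(k)}(Λ) = (I + D̄μ)QG̃₂Q*(I + μ*D̄*). (3.185)"* … *"Expanding these into random walks we get a
  random walk expansion of C^{(k)}(Λ). The formula (3.185) implies immediately bounds and an exponential decay. Thus
  we get Theorem 3.15. For Mα₀ sufficiently small the propagator C^{(k)}(Λ) is given by the formula (3.185), and
  satisfies the bound |C^{(k)}(Λ; y, y′)| ≤ B₀e^{−δ₀|y−y′|}, y, y′ ∈ Λ (3.187) with the constants B₀, δ₀ depending on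
  d and L only."*

THE READING (typing choices; D-b09.43, extending D-b09.42 (a)(b) of `B9Eq3169MuN`).
(a) BLOCK KERNELS.  The fields are 𝔤-valued bond functions ((3.155)), so C^{(k)}(Λ), E := I + D̄μ(·), S := QG̃₂Q*
    and I + μ*D̄* have, over a bond pair (b, b′), entries in End 𝔤 — typed as matrices over the bonds with entries in
    ANY real normed ring 𝔸 (`Matrix P P 𝔸`, [NormedRing 𝔸]; for the model 𝔸 = `𝔤 →L[ℝ] 𝔤` with the operator norm)
    and the print's |·| of a block as its norm in 𝔸.  The adjoint factor I + μ*D̄* = (I + D̄μ)* has the TRANSPOSED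
    block norms; typed as a third matrix F with the hypothesis ‖F(q′, q)‖ ≤ ‖E(q, q′)‖ (`hF`), discharged with
    equality by the Hilbert-space adjoint when 𝔤 is a (complete) real inner product space (§3, `Eadj`, `norm_Eadj`).
(b) THE NORM-MAJORANT REDUCTION.  ‖(E S F)(p, q)‖ ≤ (|E| · |S| · |E|ᵀ)(p, q) entrywise for the real matrices of
    norms (`nrm`, `norm_mul_mul_apply_le`: triangle inequality + submultiplicativity), so gen 11's SCALAR lemma
    `B9Thm315Decay.decay_3187_of_3185` applied to the majorants gives the block decay with the SAME constants
    (`op_decay_3187`: B₀ = B₁e^{2δ₁r}m², δ₀ = δ₁, where r = the range of E and m = its OPERATOR-NORM ROW MASS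
    Σ_{q}‖E(p, q)‖) — and the majorant matrices themselves ARE (3.185) data in the domination form `Rep3185Dom` of
    `B9Eq3169MuN` (§3), so the edge `thm315Printed_of_3185Dom` into r1's `B9.Thm315Printed` applies unchanged.
(c) THE OPERATOR ENTRIES OF E (non-abelian model of `B9Eq3169MuN` §C: a real normed space 𝔤, isometric
    transports `T b : 𝔤 ≃ₗᵢ[ℝ] 𝔤` entering the (3.169) calculus of `B9Eq3169Mu` as `Ri T`): `Eop A T b b′ :
    𝔤 →L[ℝ] 𝔤`, v ↦ E(v·𝟙_{b′})(b), with E(B)(b) = Σ_{b′} Eop(b, b′)(B(b′)) (`dress_eq_sum_Eop`); RANGE ρ(b₋, b′₋) ≤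
    D + 1 from locality (`Eop_range`, as `EmatN_range`); and the ROW MASS Σ_{b′}‖Eop(b, b′)‖ ≤ 1 + 4ℓ
    (`sum_norm_Eop_le`) by an explicit OCCUPATION COUNT: ‖(R_y(V)(v𝟙_{b′}))(Γ)‖ ≤ occ(b′, Γ)·‖v‖ with Σ_{b′} occ(b′, Γ)
    = |Γ| (`norm_trSum_single_le`, `sum_occ`), hence ‖μ(v𝟙_{b′})(x)‖ ≤ massMu(x, b′)‖v‖ with Σ_{b′} massMu(x, b′) ≤ 2ℓ and
    ‖E(v𝟙_{b′})(b)‖ ≤ mass(b, b′)‖v‖ with Σ_{b′} mass(b, b′) ≤ 1 + 4ℓ — the operator-level form of the scalar row bound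
    of `B9Eq3169Mu.sum_abs_Emat_le`, WITHOUT the √n of `B9Eq3169MuN.sum_abs_EmatN_le` (which bounds ℓ¹ rows over
    colour COORDINATES).  So at operator-norm level the constants are literally functions of d and L: on the combs of
    `B9Eq3169Comb` r = L, m = 1 + 4d(L − 1), B₀ = K·B₁e^{2δ₁L}(1 + 4d(L − 1))² (§4); the Hilbert–Schmidt reading of |·|
    costs the block-order constant K of D-b09.42 (b) (‖X‖_HS ≤ √(dim)·‖X‖_op), located, not typed.
(d) CHARTS AND S as in `B9Eq3169MuN` (D-b09.42 (c)(d)): a bond chart χ with unitDist(χ b, χ b′) = ρ(b₋, b′₋), inΛ :=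
    image χ, S : bonds × bonds → 𝔸 with ‖S(b, b′)‖ ≤ B₁e^{−δ₁ρ(b₋, b′₋)} (HYPOTHESIS), domination |C^{(k)}(Λ; y, y′)| ≤
    K·‖(E S F)(b, b′)‖ for some bond pair charted to (y, y′) (HYPOTHESIS carrying (3.185)).

WHAT THIS FILE PROVES (kernel-checked, no `sorry`).  §1 `nrm`, `norm_mul_mul_apply_le`, `op_decay_3187` (any
finite P, any real normed ring).  §2 `occ`/`sum_occ`/`norm_trSum_single_le`, `massMu`/`norm_mu_single_le`/
`sum_massMu_le` (2ℓ), `mass`/`norm_dress_single_le`/`sum_mass_le` (1 + 4ℓ), `Eop`/`Eop_apply`/`dress_eq_sum_Eop`,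
`Eop_ne_zero`/`Eop_range` (D + 1), `norm_Eop_le`, `sum_norm_Eop_le` (1 + 4ℓ).  §3 `op_bound_3187` (the literal block
bound ‖(E S F)(b, b′)‖ ≤ B₁e^{2δ₁(D+1)}(1 + 4ℓ)²e^{−δ₁ρ(b₋, b′₋)}), `rep3185Dom_of_op` (→ `Rep3185Dom … U δ₁ B₁ (D + 1)
(1 + 4ℓ) K` with the norm-majorant matrices), `Eadj`/`norm_Eadj`/`op_bound_3187_adjoint` (inner-product 𝔤).  §4 combs:
`comb_Eop_range` (L), `comb_sum_norm_Eop_le` (1 + 4d(L − 1)), `comb_rep3185Dom_op`, `comb_bound_3187_op`.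

WHAT IT DOES NOT PROVE: the factorisation (3.185) and the random-walk bound of QG̃₂Q* (hypotheses `hdom`/`hS`:
G-B9-10 (a)(b)(c), C-adv8-2 — OPEN); that I + μ*D̄* is the block-adjoint of I + D̄μ for the print's pairing (typed
as the hypothesis `hF`, discharged only for the Hilbert-space adjoint of the typed `Eop`); the Hilbert–Schmidt form
of |·| (located in (c)); C-B9-57 residual (i) (δ-function bookkeeping, Jacobian); j-fold contours, torus, incoming
boundary bonds, Euclidean |y − y′| (D-b09.40/41); optimality of 1 + 4ℓ.  Value = kernel certificate that Theorem
3.15's locality constants are functions of d and L alone at the level of operator-normed block kernels — typed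
skeleton / located gap, NOT summit progress. -/

namespace Literature.MathematicalPhysics.QuantumFieldTheory.Balaban1983to89.B9Eq3187Op

open Finset
open scoped Matrix
open B4Sect5Torus (IsPseudoDist)
open B6Elimination (BlockClosed)
open B9Eq3169Mu B9Eq3169Comb B9Eq3169MuN

/-! ## §1  Kernels with entries in a real normed ring: the norm-majorant reduction -/

section Ring

variable {P 𝔸 : Type} [Fintype P] [NormedRing 𝔸]

/-- The NORM-MAJORANT matrix |E|(p, q) = ‖E(p, q)‖ of a block kernel. [folklore] -/
def nrm (E : Matrix P P 𝔸) : Matrix P P ℝ := fun p q => ‖E p q‖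

omit [Fintype P] in
/-- Entries of the norm-majorant matrix. [folklore] -/
@[simp] theorem nrm_apply (E : Matrix P P 𝔸) (p q : P) : nrm E p q = ‖E p q‖ := rfl

/-- **THE MAJORANT**: ‖(E S F)(p, q)‖ ≤ (|E|·|S|·|E|ᵀ)(p, q) when the third factor has the transposed block norms of
the first (‖F(q′, q)‖ ≤ ‖E(q, q′)‖ — the adjoint I + μ*D̄* of I + D̄μ). [cite: Balaban1985BackgroundPropagators,
(3.185) p.432] -/
theorem norm_mul_mul_apply_le (E S F : Matrix P P 𝔸) (hF : ∀ q' q, ‖F q' q‖ ≤ ‖E q q'‖) (p q : P) :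
    ‖(E * S * F) p q‖ ≤ (nrm E * nrm S * (nrm E)ᵀ) p q := by
  simp only [Matrix.mul_apply, Matrix.transpose_apply, nrm_apply]
  refine (norm_sum_le _ _).trans (Finset.sum_le_sum fun q' _ => ?_)
  refine (norm_mul_le _ _).trans ?_
  exact mul_le_mul ((norm_sum_le _ _).trans (Finset.sum_le_sum fun p' _ => norm_mul_le _ _)) (hF q' q)
    (norm_nonneg _) (Finset.sum_nonneg fun p' _ => mul_nonneg (norm_nonneg _) (norm_nonneg _))

/-- **(3.185) ⇒ (3.187) FOR BLOCK KERNELS** over any real normed ring: if ‖S(p, q)‖ ≤ B₁e^{−δ₁ρ(p,q)}, E has range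
≤ r and operator-norm row mass Σ_q‖E(p, q)‖ ≤ m, and ‖F(q′, q)‖ ≤ ‖E(q, q′)‖, then ‖(E S F)(p, q)‖ ≤
B₁e^{2δ₁r}m²·e^{−δ₁ρ(p,q)} — gen 11's `B9Thm315Decay.decay_3187_of_3185` on the norm-majorant matrices.
[cite: Balaban1985BackgroundPropagators, (3.185)–(3.187) p.432] -/
theorem op_decay_3187 (ρ : P → P → ℝ) (hρ : IsPseudoDist ρ) (E S F : Matrix P P 𝔸) {B₁ δ₁ r m : ℝ}
    (hB₁ : 0 ≤ B₁) (hδ₁ : 0 ≤ δ₁) (hS : ∀ p q, ‖S p q‖ ≤ B₁ * Real.exp (-(δ₁ * ρ p q)))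
    (hEr : ∀ p q, E p q ≠ 0 → ρ p q ≤ r) (hE1 : ∀ p, ∑ q, ‖E p q‖ ≤ m)
    (hF : ∀ q' q, ‖F q' q‖ ≤ ‖E q q'‖) (p q : P) :
    ‖(E * S * F) p q‖ ≤ B₁ * Real.exp (2 * δ₁ * r) * m * m * Real.exp (-(δ₁ * ρ p q)) := by
  refine (norm_mul_mul_apply_le E S F hF p q).trans ((le_abs_self _).trans ?_)
  refine B9Thm315Decay.decay_3187_of_3185 ρ hρ (nrm E) (nrm S) hB₁ hδ₁ ?_ ?_ ?_ p q
  · intro u v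
    rw [nrm_apply, abs_norm]
    exact hS u v
  · intro p' u h
    exact hEr p' u fun h0 => h (by rw [nrm_apply, h0, norm_zero])
  · intro p'
    simp only [nrm_apply, abs_norm]
    exact hE1 p'

end Ring

/-! ## §2  The operator entries of E = I + D̄μ(·) in the non-abelian model: range D + 1, row mass ≤ 1 + 4ℓ -/

section Occ

variable {Bond : Type} [DecidableEq Bond]

/-- occ(b′, Γ) — the number of occurrences of the bond b′ in the chain Γ (as a real number). [folklore] -/
def occ (b' : Bond) : List Bond → ℝ
  | [] => 0
  | c :: Γ => (if c = b' then 1 else 0) + occ b' Γ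

/-- occ on the empty chain. [folklore] -/
@[simp] theorem occ_nil (b' : Bond) : occ b' ([] : List Bond) = 0 := rfl

/-- occ on a cons. [folklore] -/
@[simp] theorem occ_cons (b' c : Bond) (Γ : List Bond) :
    occ b' (c :: Γ) = (if c = b' then 1 else 0) + occ b' Γ := rfl

/-- occ ≥ 0. [folklore] -/
theorem occ_nonneg (b' : Bond) : ∀ Γ : List Bond, 0 ≤ occ b' Γ
  | [] => le_rfl
  | c :: Γ => by
      rw [occ_cons]
      exact add_nonneg (by split_ifs <;> norm_num) (occ_nonneg b' Γ)

/-- Σ_{b′} occ(b′, Γ) = |Γ|. [folklore] -/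
theorem sum_occ [Fintype Bond] : ∀ Γ : List Bond, ∑ b', occ b' Γ = Γ.length
  | [] => by simp
  | c :: Γ => by
      rw [List.length_cons, Nat.cast_succ]
      simp only [occ_cons, Finset.sum_add_distrib, sum_occ Γ, Finset.sum_ite_eq, Finset.mem_univ, if_true]
      ring

variable {𝔤 : Type} [NormedAddCommGroup 𝔤] [NormedSpace ℝ 𝔤]

omit [NormedSpace ℝ 𝔤] in
/-- ‖(v𝟙_{b′})(c)‖ ≤ [c = b′]·‖v‖. [folklore] -/
theorem norm_single_apply_le (b' c : Bond) (v : 𝔤) :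
    ‖(Pi.single b' v : Bond → 𝔤) c‖ ≤ (if c = b' then 1 else 0) * ‖v‖ := by
  by_cases h : c = b'
  · subst h
    simp
  · rw [Pi.single_eq_of_ne h, if_neg h, norm_zero, zero_mul]

/-- ‖(R_y(V)(v𝟙_{b′}))(Γ)‖ ≤ occ(b′, Γ)·‖v‖ for isometric transports. [folklore] -/
theorem norm_trSum_single_le (T : Bond → 𝔤 ≃ₗᵢ[ℝ] 𝔤) (b' : Bond) (v : 𝔤) :
    ∀ Γ : List Bond, ‖trSum (Ri T) (Pi.single b' v) Γ‖ ≤ occ b' Γ * ‖v‖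
  | [] => by simp
  | c :: Γ => by
      rw [trSum_cons, occ_cons, add_mul]
      refine (norm_add_le _ _).trans (add_le_add (norm_single_apply_le b' c v) ?_)
      rw [Ri_apply, LinearIsometryEquiv.norm_map]
      exact norm_trSum_single_le T b' v Γ

end Occ

section Op

variable {X Bond 𝔤 : Type} [Fintype X] [DecidableEq X] [Fintype Bond] [DecidableEq Bond]
  [NormedAddCommGroup 𝔤] [NormedSpace ℝ 𝔤] (A : AxialFrame X Bond) (T : Bond → 𝔤 ≃ₗᵢ[ℝ] 𝔤)

/-- massMu(x, b′) = occ(b′, Γ_{y,x}) + Σ_{x′∈B(y)} w(x′)·occ(b′, Γ_{y,x′}) — the mass with which B(b′) enters μ(B)(x).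
[cite: Balaban1985BackgroundPropagators, (3.169) p.430] -/
def massMu (x : X) (b' : Bond) : ℝ := occ b' (A.Γ x) + ∑ x' ∈ A.block x, A.w x' * occ b' (A.Γ x')

omit [Fintype Bond] in
/-- massMu ≥ 0. [folklore] -/
theorem massMu_nonneg (x : X) (b' : Bond) : 0 ≤ massMu A x b' :=
  add_nonneg (occ_nonneg _ _) (Finset.sum_nonneg fun x' _ => mul_nonneg (A.w_nonneg x') (occ_nonneg _ _))

omit [Fintype Bond] in
/-- ‖Q′(R_y(V)(v𝟙_{b′}))(Γ_{y,·})(x)‖ ≤ (Σ_{x′∈B(y)} w(x′)occ(b′, Γ_{y,x′}))·‖v‖. [folklore] -/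
theorem norm_bavg_single_le (x : X) (b' : Bond) (v : 𝔤) :
    ‖A.bavg (Ri T) (Pi.single b' v) x‖ ≤ (∑ x' ∈ A.block x, A.w x' * occ b' (A.Γ x')) * ‖v‖ := by
  unfold AxialFrame.bavg
  rw [Finset.sum_mul]
  refine (norm_sum_le _ _).trans (Finset.sum_le_sum fun x' _ => ?_)
  rw [norm_smul, Real.norm_of_nonneg (A.w_nonneg x'), mul_assoc]
  exact mul_le_mul_of_nonneg_left (norm_trSum_single_le T b' v (A.Γ x')) (A.w_nonneg x')

omit [Fintype Bond] in
/-- **‖μ(v𝟙_{b′})(x)‖ ≤ massMu(x, b′)·‖v‖** for isometric transports.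
[cite: Balaban1985BackgroundPropagators, (3.169) p.430] -/
theorem norm_mu_single_le (x : X) (b' : Bond) (v : 𝔤) :
    ‖A.mu (Ri T) (Pi.single b' v) x‖ ≤ massMu A x b' * ‖v‖ := by
  rw [AxialFrame.mu, norm_hol_symm, massMu, add_mul]
  refine (norm_sub_le _ _).trans ?_
  rw [add_comm (occ b' (A.Γ x) * ‖v‖)]
  exact add_le_add (norm_bavg_single_le A T x b' v) (norm_trSum_single_le T b' v (A.Γ x))

/-- Σ_{b′} massMu(x, b′) = |Γ_{y,x}| + Σ_{x′} w(x′)|Γ_{y,x′}| ≤ 2ℓ. [folklore] -/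
theorem sum_massMu_le {ℓ : ℝ} (hℓ : ∀ x, ((A.Γ x).length : ℝ) ≤ ℓ) (x : X) : ∑ b', massMu A x b' ≤ 2 * ℓ := by
  simp only [massMu, Finset.sum_add_distrib, sum_occ]
  rw [Finset.sum_comm]
  have h : ∑ x' ∈ A.block x, ∑ b', A.w x' * occ b' (A.Γ x') = ∑ x' ∈ A.block x, A.w x' * ((A.Γ x').length : ℝ) :=
    Finset.sum_congr rfl fun x' _ => by rw [← Finset.mul_sum, sum_occ]
  rw [h]
  have h2 : ∑ x' ∈ A.block x, A.w x' * ((A.Γ x').length : ℝ) ≤ ∑ x' ∈ A.block x, A.w x' * ℓ :=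
    Finset.sum_le_sum fun x' _ => mul_le_mul_of_nonneg_left (hℓ x') (A.w_nonneg x')
  rw [← Finset.sum_mul, A.sum_w, one_mul] at h2
  linarith [hℓ x]

/-- mass(b, b′) = [b = b′] + massMu(b₊, b′) + massMu(b₋, b′) — the mass with which B(b′) enters E(B)(b) = B(b) +
R(V(b))μ(b₊) − μ(b₋). [cite: Balaban1985BackgroundPropagators, (3.169) p.430 + (3.185) p.432] -/
def mass (b b' : Bond) : ℝ := (if b = b' then 1 else 0) + massMu A (A.tgt b) b' + massMu A (A.src b) b'

omit [Fintype Bond] in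
/-- mass ≥ 0. [folklore] -/
theorem mass_nonneg (b b' : Bond) : 0 ≤ mass A b b' :=
  add_nonneg (add_nonneg (by split_ifs <;> norm_num) (massMu_nonneg A _ _)) (massMu_nonneg A _ _)

omit [Fintype Bond] in
/-- **‖E(v𝟙_{b′})(b)‖ ≤ mass(b, b′)·‖v‖** for isometric transports.
[cite: Balaban1985BackgroundPropagators, (3.169) p.430 + (3.185) p.432] -/
theorem norm_dress_single_le (b b' : Bond) (v : 𝔤) :
    ‖A.dress (Ri T) (Pi.single b' v) b‖ ≤ mass A b b' * ‖v‖ := by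
  rw [AxialFrame.dress, Pi.add_apply, cod_apply, Ri_apply, mass, add_mul, add_mul]
  refine (norm_add_le _ _).trans ?_
  refine (add_le_add (norm_single_apply_le b' b v) ((norm_sub_le _ _).trans
    (add_le_add (le_of_eq (LinearIsometryEquiv.norm_map _ _)) le_rfl))).trans ?_
  have h1 := norm_mu_single_le A T (A.tgt b) b' v
  have h2 := norm_mu_single_le A T (A.src b) b' v
  linarith

/-- **ROW MASS Σ_{b′} mass(b, b′) ≤ 1 + 4ℓ** (contours of length ≤ ℓ, block weights summing to 1).
[cite: Balaban1985BackgroundPropagators, (3.185) p.432 ("depending on d and L only")] -/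
theorem sum_mass_le {ℓ : ℝ} (hℓ : ∀ x, ((A.Γ x).length : ℝ) ≤ ℓ) (b : Bond) : ∑ b', mass A b b' ≤ 1 + 4 * ℓ := by
  simp only [mass, Finset.sum_add_distrib, Finset.sum_ite_eq, Finset.mem_univ, if_true]
  have h1 := sum_massMu_le A hℓ (A.tgt b)
  have h2 := sum_massMu_le A hℓ (A.src b)
  linarith

/-- **THE OPERATOR ENTRIES OF E = I + D̄μ(·)**: Eop(b, b′) ∈ End 𝔤, v ↦ E(v𝟙_{b′})(b) — a bounded operator of norm
≤ mass(b, b′). [cite: Balaban1985BackgroundPropagators, (3.169) p.430 + (3.185) p.432] -/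
noncomputable def Eop : Matrix Bond Bond (𝔤 →L[ℝ] 𝔤) := fun b b' =>
  LinearMap.mkContinuous
    { toFun := fun v => A.dress (Ri T) (Pi.single b' v) b
      map_add' := fun v w => by
        rw [Pi.single_add, AxialFrame.dress_add]
        rfl
      map_smul' := fun c v => by
        rw [Pi.single_smul, AxialFrame.dress_smul]
        rfl }
    (mass A b b') (fun v => norm_dress_single_le A T b b' v)

omit [Fintype Bond] in
/-- Eop(b, b′)v = E(v𝟙_{b′})(b). [folklore] -/
@[simp] theorem Eop_apply (b b' : Bond) (v : 𝔤) : Eop A T b b' v = A.dress (Ri T) (Pi.single b' v) b := rfl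

/-- **E(B)(b) = Σ_{b′} Eop(b, b′)(B(b′))** — E is the block matrix (Eop(b, b′)).
[cite: Balaban1985BackgroundPropagators, (3.185) p.432] -/
theorem dress_eq_sum_Eop (B : Bond → 𝔤) (b : Bond) : A.dress (Ri T) B b = ∑ b', Eop A T b b' (B b') := by
  conv_lhs => rw [← Finset.univ_sum_single B, ← AxialFrame.dressLin_apply, map_sum, Finset.sum_apply]
  refine Finset.sum_congr rfl fun b' _ => ?_
  rw [AxialFrame.dressLin_apply, Eop_apply]

omit [Fintype Bond] in
/-- **RANGE, combinatorial form**: Eop(b, b′) ≠ 0 ⇒ b′ = b, or b′ is an axial bond of the block of b₊ or of b₋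
(locality `B9Eq3169MuN.dress_eq_zero_of_vanish`). [cite: Balaban1985BackgroundPropagators, (3.169) p.430] -/
theorem Eop_ne_zero {b b' : Bond} (h : Eop A T b b' ≠ 0) :
    b' = b ∨ A.InAx (A.tgt b) b' ∨ A.InAx (A.src b) b' := by
  by_contra hc
  simp only [not_or] at hc
  apply h
  ext v
  rw [Eop_apply, zero_apply]
  refine dress_eq_zero_of_vanish A (Ri T) ?_ ?_ ?_
  · rw [Pi.single_apply, if_neg]
    rintro rfl
    exact hc.1 rfl
  · intro c hc'
    rw [Pi.single_apply, if_neg]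
    rintro rfl
    exact hc.2.2 hc'
  · intro c hc'
    rw [Pi.single_apply, if_neg]
    rintro rfl
    exact hc.2.1 hc'

omit [Fintype Bond] in
/-- **RANGE, metric form**: blocks of ρ-diameter ≤ D, bonds of ρ-length ≤ 1, axial bonds sourced in their block ⇒
Eop(b, b′) ≠ 0 → ρ(b₋, b′₋) ≤ D + 1 — the same range as the scalar model.
[cite: Balaban1985BackgroundPropagators, (3.169) p.430 + (3.187) p.432] -/
theorem Eop_range (ρ : X → X → ℝ) (hρ : IsPseudoDist ρ) {D : ℝ}
    (hdiam : ∀ x x', A.blk x' = A.blk x → ρ x x' ≤ D) (hbond : ∀ b, ρ (A.src b) (A.tgt b) ≤ 1)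
    (hin : ∀ x b', b' ∈ A.Γ x → A.blk (A.src b') = A.blk x) :
    ∀ b b', Eop A T b b' ≠ 0 → ρ (A.src b) (A.src b') ≤ D + 1 := by
  intro b b' h
  have hD : 0 ≤ D := le_trans (le_of_eq (hρ.zero _).symm) (hdiam (A.src b) (A.src b) rfl)
  have hAx : ∀ x, A.InAx x b' → ρ x (A.src b') ≤ D := by
    rintro x ⟨x', hx', hb'⟩
    exact hdiam x (A.src b') (by rw [hin x' b' hb', hx'])
  rcases Eop_ne_zero A T h with h1 | h2 | h3
  · rw [h1, hρ.zero]
    linarith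
  · calc ρ (A.src b) (A.src b') ≤ ρ (A.src b) (A.tgt b) + ρ (A.tgt b) (A.src b') := hρ.triangle _ _ _
      _ ≤ 1 + D := add_le_add (hbond b) (hAx _ h2)
      _ = D + 1 := add_comm _ _
  · linarith [hAx _ h3]

omit [Fintype Bond] in
/-- ‖Eop(b, b′)‖ ≤ mass(b, b′) (operator norm). [folklore] -/
theorem norm_Eop_le (b b' : Bond) : ‖Eop A T b b'‖ ≤ mass A b b' :=
  ContinuousLinearMap.opNorm_le_bound _ (mass_nonneg A b b') (norm_dress_single_le A T b b')

/-- **OPERATOR-NORM ROW MASS Σ_{b′}‖Eop(b, b′)‖ ≤ 1 + 4ℓ** — the constant of the scalar model, no dim 𝔤 factor.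
[cite: Balaban1985BackgroundPropagators, (3.185) p.432 ("depending on d and L only")] -/
theorem sum_norm_Eop_le {ℓ : ℝ} (hℓ : ∀ x, ((A.Γ x).length : ℝ) ≤ ℓ) (b : Bond) :
    ∑ b', ‖Eop A T b b'‖ ≤ 1 + 4 * ℓ :=
  (Finset.sum_le_sum fun b' _ => norm_Eop_le A T b b').trans (sum_mass_le A hℓ b)

/-! ## §3  The edges: the literal block bound, `Rep3185Dom` from the majorants, the adjoint instance -/

/-- **(3.187) FOR THE BLOCK KERNEL C = E·S·F AT OPERATOR-NORM LEVEL**: with ‖S(b, b′)‖ ≤ B₁e^{−δ₁ρ(b₋,b′₋)} and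
‖F(b′, b)‖ ≤ ‖Eop(b, b′)‖, ‖(E S F)(b, b′)‖ ≤ B₁e^{2δ₁(D+1)}(1 + 4ℓ)²·e^{−δ₁ρ(b₋, b′₋)} — (3.185) itself and the
random-walk bound being the inputs. [cite: Balaban1985BackgroundPropagators, (3.185)–(3.187) p.432] -/
theorem op_bound_3187 {δ₁ B₁ D ℓ : ℝ} (hℓ : ∀ x, ((A.Γ x).length : ℝ) ≤ ℓ) (ρ : X → X → ℝ) (hρ : IsPseudoDist ρ)
    (hdiam : ∀ x x', A.blk x' = A.blk x → ρ x x' ≤ D) (hbond : ∀ b, ρ (A.src b) (A.tgt b) ≤ 1)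
    (hin : ∀ x b', b' ∈ A.Γ x → A.blk (A.src b') = A.blk x) (hB₁ : 0 ≤ B₁) (hδ₁ : 0 ≤ δ₁)
    (S F : Matrix Bond Bond (𝔤 →L[ℝ] 𝔤))
    (hS : ∀ b b', ‖S b b'‖ ≤ B₁ * Real.exp (-(δ₁ * ρ (A.src b) (A.src b'))))
    (hF : ∀ b' b, ‖F b' b‖ ≤ ‖Eop A T b b'‖) (b b' : Bond) :
    ‖(Eop A T * S * F) b b'‖ ≤
      B₁ * Real.exp (2 * δ₁ * (D + 1)) * (1 + 4 * ℓ) * (1 + 4 * ℓ) * Real.exp (-(δ₁ * ρ (A.src b) (A.src b'))) :=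
  op_decay_3187 (fun p q => ρ (A.src p) (A.src q)) (hρ.comp A.src) (Eop A T) S F hB₁ hδ₁ hS
    (Eop_range A T ρ hρ hdiam hbond hin) (sum_norm_Eop_le A T hℓ) hF b b'

/-- **THE NORM-MAJORANT MATRICES ARE (3.185) DATA IN DOMINATION FORM**: for a bond chart χ with unitDist(χ b, χ b′)
= ρ(b₋, b′₋), the random-walk bound on the blocks of S, the transposed-norm condition on F and the domination
|C^{(k)}(Λ; y, y′)| ≤ K·‖(E S F)(b, b′)‖ over some charted bond pair: `Rep3185Dom … U δ₁ B₁ (D + 1) (1 + 4ℓ) K` — so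
`B9Eq3169MuN.thm315Printed_of_3185Dom` applies with m = 1 + 4ℓ.
[cite: Balaban1985BackgroundPropagators, (3.185)–(3.187) p.432] -/
theorem rep3185Dom_of_op {g : B9.Geometry} {Bg : B9.Backgrounds} {Ck : B9.SiteKernel g Bg}
    {inΛ : g.Site → Prop} {unitDist : g.Site → g.Site → ℝ} {U : Bg.Cfg} {δ₁ B₁ D ℓ K : ℝ}
    (hℓ : ∀ x, ((A.Γ x).length : ℝ) ≤ ℓ) (ρ : X → X → ℝ) (hρ : IsPseudoDist ρ)
    (hdiam : ∀ x x', A.blk x' = A.blk x → ρ x x' ≤ D) (hbond : ∀ b, ρ (A.src b) (A.tgt b) ≤ 1)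
    (hin : ∀ x b', b' ∈ A.Γ x → A.blk (A.src b') = A.blk x)
    (χ : Bond → g.Site) (hχ : ∀ b b', unitDist (χ b) (χ b') = ρ (A.src b) (A.src b'))
    (S F : Matrix Bond Bond (𝔤 →L[ℝ] 𝔤))
    (hS : ∀ b b', ‖S b b'‖ ≤ B₁ * Real.exp (-(δ₁ * unitDist (χ b) (χ b'))))
    (hF : ∀ b' b, ‖F b' b‖ ≤ ‖Eop A T b b'‖) (hK : 0 ≤ K)
    (hdom : ∀ y y', inΛ y → inΛ y' → ∃ b b', χ b = y ∧ χ b' = y' ∧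
      |Ck.ker U y y'| ≤ K * ‖(Eop A T * S * F) b b'‖) :
    Rep3185Dom g Bg Ck inΛ unitDist U δ₁ B₁ (D + 1) (1 + 4 * ℓ) K := by
  refine ⟨Bond, inferInstance, χ, nrm (Eop A T), nrm S, isPseudoDist_chart unitDist A.src ρ hρ χ hχ,
    ?_, ?_, ?_, ?_⟩
  · intro p q
    rw [nrm_apply, abs_norm]
    exact hS p q
  · intro p q h
    rw [hχ]
    exact Eop_range A T ρ hρ hdiam hbond hin p q fun h0 => h (by rw [nrm_apply, h0, norm_zero])
  · intro p
    simp only [nrm_apply, abs_norm]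
    exact sum_norm_Eop_le A T hℓ p
  · intro y y' hy hy'
    obtain ⟨b, b', hb, hb', hle⟩ := hdom y y' hy hy'
    exact ⟨b, b', hb, hb', hle.trans
      (mul_le_mul_of_nonneg_left ((norm_mul_mul_apply_le _ S F hF b b').trans (le_abs_self _)) hK)⟩

end Op

section Adjoint

variable {X Bond 𝔤 : Type} [Fintype X] [DecidableEq X] [Fintype Bond] [DecidableEq Bond]
  [NormedAddCommGroup 𝔤] [InnerProductSpace ℝ 𝔤] [CompleteSpace 𝔤]
  (A : AxialFrame X Bond) (T : Bond → 𝔤 ≃ₗᵢ[ℝ] 𝔤)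

/-- THE ADJOINT FACTOR I + μ*D̄* for a (complete) real inner-product 𝔤: F(b′, b) = Eop(b, b′)† (Hilbert-space
adjoint of the operator entries). [cite: Balaban1985BackgroundPropagators, (3.185) p.432] -/
noncomputable def Eadj : Matrix Bond Bond (𝔤 →L[ℝ] 𝔤) := fun b' b => ContinuousLinearMap.adjoint (Eop A T b b')

omit [Fintype Bond] in
/-- ‖Eop(b, b′)†‖ = ‖Eop(b, b′)‖. [folklore] -/
theorem norm_Eadj (b' b : Bond) : ‖Eadj A T b' b‖ = ‖Eop A T b b'‖ :=
  LinearIsometryEquiv.norm_map _ _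

/-- (3.187) for C = E·S·E† at operator-norm level on a real inner-product 𝔤: ‖(E S E†)(b, b′)‖ ≤
B₁e^{2δ₁(D+1)}(1 + 4ℓ)²·e^{−δ₁ρ(b₋, b′₋)}. [cite: Balaban1985BackgroundPropagators, (3.185)–(3.187) p.432] -/
theorem op_bound_3187_adjoint {δ₁ B₁ D ℓ : ℝ} (hℓ : ∀ x, ((A.Γ x).length : ℝ) ≤ ℓ) (ρ : X → X → ℝ)
    (hρ : IsPseudoDist ρ) (hdiam : ∀ x x', A.blk x' = A.blk x → ρ x x' ≤ D)
    (hbond : ∀ b, ρ (A.src b) (A.tgt b) ≤ 1) (hin : ∀ x b', b' ∈ A.Γ x → A.blk (A.src b') = A.blk x)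
    (hB₁ : 0 ≤ B₁) (hδ₁ : 0 ≤ δ₁) (S : Matrix Bond Bond (𝔤 →L[ℝ] 𝔤))
    (hS : ∀ b b', ‖S b b'‖ ≤ B₁ * Real.exp (-(δ₁ * ρ (A.src b) (A.src b')))) (b b' : Bond) :
    ‖(Eop A T * S * Eadj A T) b b'‖ ≤
      B₁ * Real.exp (2 * δ₁ * (D + 1)) * (1 + 4 * ℓ) * (1 + 4 * ℓ) * Real.exp (-(δ₁ * ρ (A.src b) (A.src b'))) :=
  op_bound_3187 A T hℓ ρ hρ hdiam hbond hin hB₁ hδ₁ S (Eadj A T) hS (fun b' b => (norm_Eadj A T b' b).le) b b'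

end Adjoint

/-! ## §4  The comb instance: r = L, m = 1 + 4d(L − 1), B₀ = K·B₁e^{2δ₁L}(1 + 4d(L − 1))² -/

section Comb

variable {d L : ℕ} {𝔤 : Type} [NormedAddCommGroup 𝔤] [NormedSpace ℝ 𝔤]

/-- RANGE ≤ L for the operator entries on a union of L-blocks of ℤ^d (sup-distance of initial points).
[cite: Balaban1985BackgroundPropagators, p.432 ("depending on d and L only")] -/
theorem comb_Eop_range (hL : 0 < L) {Λ : Finset (Fin d → ℤ)} (hΛ : BlockClosed L Λ) (M : BondModel L Λ)
    (T : ↥M.bd → 𝔤 ≃ₗᵢ[ℝ] 𝔤) (p q : ↥M.bd) (h : Eop (M.frame hL hΛ) T p q ≠ 0) : dist p.1.1 q.1.1 ≤ L := by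
  have h1 := Eop_range (M.frame hL hΛ) T (fun x x' : ↥M.sites => dist x.1 x'.1) M.isPseudoDist_dist
    (M.frame_hdiam hL hΛ) (M.frame_hbond hL hΛ) (M.frame_hin hL hΛ) p q h
  have h2 : ((L : ℝ) - 1) + 1 = L := by ring
  rw [h2] at h1
  exact h1

/-- OPERATOR-NORM ROW MASS ≤ 1 + 4d(L − 1) on a union of L-blocks of ℤ^d — no dim 𝔤 factor.
[cite: Balaban1985BackgroundPropagators, p.432 ("depending on d and L only")] -/
theorem comb_sum_norm_Eop_le (hL : 0 < L) {Λ : Finset (Fin d → ℤ)} (hΛ : BlockClosed L Λ) (M : BondModel L Λ)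
    (T : ↥M.bd → 𝔤 ≃ₗᵢ[ℝ] 𝔤) (p : ↥M.bd) :
    ∑ q, ‖Eop (M.frame hL hΛ) T p q‖ ≤ 1 + 4 * (d * ((L : ℝ) - 1)) :=
  sum_norm_Eop_le (M.frame hL hΛ) T (M.length_frame_Γ_le hL hΛ) p

/-- **THE OPERATOR-LEVEL COMB EDGE**: Λ ⊂ ℤ^d a union of L-blocks, any bond convention M, isometric transports on a
real normed 𝔤, a bond chart χ with |χ b − χ b′| = |b₋ − b′₋|_∞, the random-walk bound on the blocks of S, the
transposed-norm condition on F and the block-dominated factorisation (3.185) as hypotheses: `Rep3185Dom … U δ₁ B₁ L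
(1 + 4d(L − 1)) K` for `inΛ` = the image of χ — constants depending on d and L only.
[cite: Balaban1985BackgroundPropagators, (3.185) + (3.187) p.432] -/
theorem comb_rep3185Dom_op (hL : 0 < L) {Λ : Finset (Fin d → ℤ)} (hΛ : BlockClosed L Λ) (M : BondModel L Λ)
    (T : ↥M.bd → 𝔤 ≃ₗᵢ[ℝ] 𝔤)
    {g : B9.Geometry} {Bg : B9.Backgrounds} {Ck : B9.SiteKernel g Bg} {unitDist : g.Site → g.Site → ℝ}
    {U : Bg.Cfg} {δ₁ B₁ K : ℝ} (χ : ↥M.bd → g.Site) (hχ : ∀ b b', unitDist (χ b) (χ b') = dist b.1.1 b'.1.1)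
    (S F : Matrix ↥M.bd ↥M.bd (𝔤 →L[ℝ] 𝔤))
    (hS : ∀ b b', ‖S b b'‖ ≤ B₁ * Real.exp (-(δ₁ * unitDist (χ b) (χ b'))))
    (hF : ∀ b' b, ‖F b' b‖ ≤ ‖Eop (M.frame hL hΛ) T b b'‖) (hK : 0 ≤ K)
    (hdom : ∀ y y', (∃ b, χ b = y) → (∃ b, χ b = y') → ∃ b b', χ b = y ∧ χ b' = y' ∧
      |Ck.ker U y y'| ≤ K * ‖(Eop (M.frame hL hΛ) T * S * F) b b'‖) :
    Rep3185Dom g Bg Ck (fun y => ∃ b, χ b = y) unitDist U δ₁ B₁ L (1 + 4 * (d * ((L : ℝ) - 1))) K := by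
  have hχ' : ∀ b b', unitDist (χ b) (χ b') = dist ((M.frame hL hΛ).src b).1 ((M.frame hL hΛ).src b').1 := by
    intro b b'; rw [hχ]; rfl
  have h := rep3185Dom_of_op (inΛ := fun y => ∃ b, χ b = y) (M.frame hL hΛ) T (M.length_frame_Γ_le hL hΛ)
    (fun x x' : ↥M.sites => dist x.1 x'.1) M.isPseudoDist_dist (M.frame_hdiam hL hΛ) (M.frame_hbond hL hΛ)
    (M.frame_hin hL hΛ) χ hχ' S F hS hF hK hdom
  have h2 : ((L : ℝ) - 1) + 1 = L := by ring
  rw [h2] at h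
  exact h

/-- … hence (3.187) at operator-norm level for all charted bond pairs: |C^{(k)}(Λ; χ b, χ b′)| ≤
K·B₁e^{2δ₁L}(1 + 4d(L − 1))²·e^{−δ₁|b₋ − b′₋|} — B₀ a function of d, L (and B₁, δ₁, K) with NO dim 𝔤 factor.
[cite: Balaban1985BackgroundPropagators, (3.187) p.432] -/
theorem comb_bound_3187_op (hL : 0 < L) {Λ : Finset (Fin d → ℤ)} (hΛ : BlockClosed L Λ) (M : BondModel L Λ)
    (T : ↥M.bd → 𝔤 ≃ₗᵢ[ℝ] 𝔤)
    {g : B9.Geometry} {Bg : B9.Backgrounds} {Ck : B9.SiteKernel g Bg} {unitDist : g.Site → g.Site → ℝ}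
    {U : Bg.Cfg} {δ₁ B₁ K : ℝ} (hB₁ : 0 ≤ B₁) (hδ₁ : 0 ≤ δ₁) (hK : 0 ≤ K)
    (χ : ↥M.bd → g.Site) (hχ : ∀ b b', unitDist (χ b) (χ b') = dist b.1.1 b'.1.1)
    (S F : Matrix ↥M.bd ↥M.bd (𝔤 →L[ℝ] 𝔤))
    (hS : ∀ b b', ‖S b b'‖ ≤ B₁ * Real.exp (-(δ₁ * unitDist (χ b) (χ b'))))
    (hF : ∀ b' b, ‖F b' b‖ ≤ ‖Eop (M.frame hL hΛ) T b b'‖)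
    (hdom : ∀ y y', (∃ b, χ b = y) → (∃ b, χ b = y') → ∃ b b', χ b = y ∧ χ b' = y' ∧
      |Ck.ker U y y'| ≤ K * ‖(Eop (M.frame hL hΛ) T * S * F) b b'‖)
    (b b' : ↥M.bd) :
    |Ck.ker U (χ b) (χ b')| ≤ K * (B₁ * Real.exp (2 * δ₁ * L) * (1 + 4 * (d * ((L : ℝ) - 1))) *
      (1 + 4 * (d * ((L : ℝ) - 1)))) * Real.exp (-(δ₁ * dist b.1.1 b'.1.1)) := by
  rw [← hχ]
  exact bound_of_rep3185Dom hB₁ hδ₁ hK (comb_rep3185Dom_op hL hΛ M T χ hχ S F hS hF hK hdom) (χ b) (χ b')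
    ⟨b, rfl⟩ ⟨b', rfl⟩

end Comb

end Literature.MathematicalPhysics.QuantumFieldTheory.Balaban1983to89.B9Eq3187Op
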